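import Mathlib
import HarnessLib
import Summits.HubbardSuperconductivity.HubbardSuperconductivity.Theorems.KLProgrammeKLRegimeEngineTowerWtPowLawBaseTokX
import Summits.HubbardSuperconductivity.HubbardSuperconductivity.Theorems.KLProgrammeKLRegimeEngineTowerWtPowTwoLegExport

/-!
# Route `KLProgramme` — crux K3 ENGINE (stmt-HubbardSuperconductivity-20437 `KLRegimeEngineV17F2`), stub (b) / E1 interface (E2) in-tower route and located risk #17
# «(C2)-MOMENTS» / located «(E2)-ROUTE-TADPOLE»: THE DEGREE-`Dw` LAW AND THE TWO-LEG TADPOLE-FREE EXPORT IN ONE STATEMENT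
# (recipe «(E2)-POW3-TRACK» item T6, HOME/hubbard-kl-k3c3-p2/g19/E2-POW3-TRACK-RECIPE.md; pen g27 (R472)(D), (R479); cell gate-hubbard-kl, seat hubbard-kl-k3c3-p2 g20)

`klTowerBornWtPowAt_le_law_of_inputs_base_tokX` (…TowerWtPowLawBaseTokX, W1 at weight power `Dw`) composed with `klTowerBornWtPowSubTadAt_two_le_of_rows`
(…TowerWtPowTwoLegExport §2): W1's hypotheses VERBATIM plus the tadpole-free two-leg step `hstep₂` at the blocks `1 ≤ k ≤ K_b` (served by
`wtPowTwoLegSub_hstep_of_blockBounds` from the same per-block data as the law's `hstep`) ⊢ the law's three conjuncts AND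
`∀ k, 1 ≤ k ≤ K_b → klTowerBornWtPowSubTadAt … d k j Dw 2 / klLevUnitF β M 0 1 (dk) ≤ X₂`, `X₂ = 15σ²(ι₃λ²) + A′(4Q′)x₁³/(1−x₁) + eψG·ΦG/(1−ΦG)`,
`G = τ(ι₁λ + ι₂/(2Q′) + ι₃/(4Q′²) + A′Q′/4)` — under the law's own numerics, no new smallness.

* **`klTowerBornWtPowAt_le_law_of_inputs_base_tokX_twoLeg (j d Kb D Dw)`**.
Composition of landed theorems; block constants are HYPOTHESES of the links; nothing asserts (E2), (X).3, (b), any stub, K3 or superconductivity.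
References: BGM 2006 §2.7 (2.70)–(2.71a), §2.8 (2.83), (2.93)–(2.98), §3 (3.2)–(3.8) [cite: BenfattoGiulianiMastropietro2006].
-/

noncomputable section

namespace Summit.HubbardSuperconductivity.HubbardSuperconductivity.Theorems.EngineV8

set_option linter.dupNamespace false -- summit = problem name (single-conjunct summit), D-0017

open Classical
open Real Finset Literature.MathematicalPhysics.QuantumLattice Literature.Probability.LatticeModels GrassmannAlgebra
open Literature.MathematicalPhysics.QuantumLattice.FermiRG
open Summit.HubbardSuperconductivity.HubbardSuperconductivity.Theorems.KLProgrammeLegKernels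
open Summit.HubbardSuperconductivity.HubbardSuperconductivity.Theorems.KLRegimeSplit
open Summit.HubbardSuperconductivity.HubbardSuperconductivity.Theorems.DispersionFlow

/-! ## The degree-`Dw` law AND the two-leg tadpole-free export, one statement -/

section LawTwoLeg

variable {L M : ℕ} [NeZero L] [NeZero M]

/-- **THE RE-BASED ONE-TRACK DEGREE-`Dw` WEIGHTED TOWER LAW WITH THE TWO-LEG TADPOLE-FREE BORN ROW EXPORTED** — `klTowerBornWtPowAt_le_law_of_inputs_base_tokX`
(…TowerWtPowLawBaseTokX) composed with `klTowerBornWtPowSubTadAt_two_le_of_rows`: W1's hypotheses VERBATIM plus the two-leg tadpole-free step `hstep₂` at the blocks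
`1 ≤ k ≤ K_b` ⊢ the law's three conjuncts AND `∀ k, 1 ≤ k ≤ K_b → klTowerBornWtPowSubTadAt … d k j Dw 2 / klLevUnitF β M 0 1 (dk) ≤ 15σ²(ι₃λ²) + A′(4Q′)x₁³/(1−x₁) + eψG·ΦG/(1−ΦG)`.
[cite: BenfattoGiulianiMastropietro2006, (2.70)-(2.71a), §2.8 (2.83), (2.93)-(2.98)] -/
theorem klTowerBornWtPowAt_le_law_of_inputs_base_tokX_twoLeg {β : ℝ} (hβ : 0 < β) (U μ : ℝ) (K : TrigPolyC4v)
    (j d Kb D Dw : ℕ) {A lam Q W Z A' Q' σ Φ ψ τ ι₁ ι₂ ι₃ : ℝ} {Zk : ℕ → Prop} (hD3 : 3 ≤ D)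
    (hA : 0 ≤ A) (hlam : 0 < lam) (hQ : 0 ≤ Q) (hW : 0 ≤ W) (hZ : 0 ≤ Z) (hA'0 : 0 ≤ A') (hQ'0 : 0 < Q')
    (hσ : 0 ≤ σ) (hΦ : 0 ≤ Φ) (hψ : 0 ≤ ψ) (hτ : 0 < τ)
    (hbase : ∀ m, 4 ≤ m → m ≤ D →
      W * Z ^ m * (klTowerMeasWtPowAt L M β U μ K d 1 j Dw (2 * m) / klLevUnitF β M 0 m (d * 1 - 1)) ≤ A' * lam ^ (m - 1) * Q' ^ m)
    (hR : ∀ k, 2 ≤ k → k ≤ Kb →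
      (∀ k', 2 ≤ k' → k' ≤ k → ∀ p, 3 ≤ p → p ≤ D →
        klTowerBornWtPowAt L M β U μ K d (k' - 1) j Dw (2 * p) / klLevUnitF β M 0 p (d * (k' - 1)) ≤ A * lam ^ (p - 1) * Q ^ p) →
      ∀ m, 4 ≤ m → m ≤ D →
        W * Z ^ m * (klTowerMeasWtPowAt L M β U μ K d k j Dw (2 * m) / klLevUnitF β M 0 m (d * k - 1)) ≤ A' * lam ^ (m - 1) * Q' ^ m)
    (hι₁ : ∀ k, 1 ≤ k → k ≤ Kb → W * Z ^ 1 * (klTowerMeasWtPowAt L M β U μ K d k j Dw (2 * 1) / klLevUnitF β M 0 1 (d * k - 1)) ≤ ι₁ * lam)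
    (hι₂ : ∀ k, 1 ≤ k → k ≤ Kb → W * Z ^ 2 * (klTowerMeasWtPowAt L M β U μ K d k j Dw (2 * 2) / klLevUnitF β M 0 2 (d * k - 1)) ≤ ι₂ * lam)
    (hι₃ : ∀ k, 1 ≤ k → k ≤ Kb → W * Z ^ 3 * (klTowerMeasWtPowAt L M β U μ K d k j Dw (2 * 3) / klLevUnitF β M 0 3 (d * k - 1)) ≤ ι₃ * lam ^ 2)
    (hZ1 : Zk 1)
    (hZsucc : ∀ k, 1 ≤ k → k < Kb → Zk k →
      Φ * towerV D τ (fun m => W * Z ^ m * (klTowerMeasWtPowAt L M β U μ K d k j Dw (2 * m) / klLevUnitF β M 0 m (d * k - 1))) < 1 → Zk (k + 1))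
    (hstep : ∀ k, 1 ≤ k → k < Kb → Zk k → ∀ N : ℕ, 2 ≤ N → ∀ p, 3 ≤ p → p ≤ D →
      Φ * towerV D τ (fun m => W * Z ^ m * (klTowerMeasWtPowAt L M β U μ K d k j Dw (2 * m) / klLevUnitF β M 0 m (d * k - 1))) < 1 →
      klTowerBornWtPowAt L M β U μ K d k j Dw (2 * p) / klLevUnitF β M 0 p (d * k) ≤
        towerFO D σ (fun m => W * Z ^ m * (klTowerMeasWtPowAt L M β U μ K d k j Dw (2 * m) / klLevUnitF β M 0 m (d * k - 1))) p +
          ∑ n ∈ Icc 2 N, exp 1 * Φ ^ (n - 1) * ψ ^ p *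
            towerS D τ (fun m => W * Z ^ m * (klTowerMeasWtPowAt L M β U μ K d k j Dw (2 * m) / klLevUnitF β M 0 m (d * k - 1))) n p +
          ψ ^ p * exp 1 * towerV D τ (fun m => W * Z ^ m * (klTowerMeasWtPowAt L M β U μ K d k j Dw (2 * m) / klLevUnitF β M 0 m (d * k - 1))) *
            (Φ * towerV D τ (fun m => W * Z ^ m * (klTowerMeasWtPowAt L M β U μ K d k j Dw (2 * m) / klLevUnitF β M 0 m (d * k - 1)))) ^ N /
            (1 - Φ * towerV D τ (fun m => W * Z ^ m * (klTowerMeasWtPowAt L M β U μ K d k j Dw (2 * m) / klLevUnitF β M 0 m (d * k - 1)))))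
    -- the tadpole-free two-leg step at blocks 1 ≤ k ≤ Kb
    (hstep₂ : ∀ k, 1 ≤ k → k ≤ Kb → Zk k → ∀ N : ℕ, 2 ≤ N →
      Φ * towerV D τ (fun m => W * Z ^ m * (klTowerMeasWtPowAt L M β U μ K d k j Dw (2 * m) / klLevUnitF β M 0 m (d * k - 1))) < 1 →
      klTowerBornWtPowSubTadAt L M β U μ K d k j Dw 2 / klLevUnitF β M 0 1 (d * k) ≤
        towerFO D σ (fun m => if 2 < m then W * Z ^ m * (klTowerMeasWtPowAt L M β U μ K d k j Dw (2 * m) / klLevUnitF β M 0 m (d * k - 1)) else 0) 1 +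
          ∑ n ∈ Icc 2 N, exp 1 * Φ ^ (n - 1) * ψ ^ 1 *
            towerS D τ (fun m => W * Z ^ m * (klTowerMeasWtPowAt L M β U μ K d k j Dw (2 * m) / klLevUnitF β M 0 m (d * k - 1))) n 1 +
          ψ ^ 1 * exp 1 * towerV D τ (fun m => W * Z ^ m * (klTowerMeasWtPowAt L M β U μ K d k j Dw (2 * m) / klLevUnitF β M 0 m (d * k - 1))) *
            (Φ * towerV D τ (fun m => W * Z ^ m * (klTowerMeasWtPowAt L M β U μ K d k j Dw (2 * m) / klLevUnitF β M 0 m (d * k - 1)))) ^ N /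
            (1 - Φ * towerV D τ (fun m => W * Z ^ m * (klTowerMeasWtPowAt L M β U μ K d k j Dw (2 * m) / klLevUnitF β M 0 m (d * k - 1)))))
    (hx₁ : 4 * σ * lam * Q' < 1) (hx₂ : 2 * lam * τ * Q' ≤ 1) (hx₃ : exp 1 * τ * lam * Q' < 1)
    (hy : Φ * (τ * (ι₁ * lam + ι₂ / (2 * Q') + ι₃ / (4 * Q' ^ 2) + A' * Q' / 4)) < 1)
    (hθ : Φ * (exp 1 * τ * (ι₁ * lam) + (exp 1 * τ) ^ 2 * (ι₂ * lam) + (exp 1 * τ) ^ 3 * (ι₃ * lam ^ 2) +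
      A' * (exp 1 * τ * Q') * ((exp 1 * τ * lam * Q') ^ 3 / (1 - exp 1 * τ * lam * Q'))) < 1)
    (hu₁ : 4 * Q' ≤ Q) (hu₂ : 2 * τ * ψ * Q' ≤ Q)
    (hclose : A' * (4 * Q') ^ 3 * (4 * σ * lam * Q' / (1 - 4 * σ * lam * Q')) +
      exp 1 * ψ * (2 * τ * ψ * Q') ^ 2 * (τ * (ι₁ * lam + ι₂ / (2 * Q') + ι₃ / (4 * Q' ^ 2) + A' * Q' / 4)) *
        (Φ * (τ * (ι₁ * lam + ι₂ / (2 * Q') + ι₃ / (4 * Q' ^ 2) + A' * Q' / 4)) /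
          (1 - Φ * (τ * (ι₁ * lam + ι₂ / (2 * Q') + ι₃ / (4 * Q' ^ 2) + A' * Q' / 4)))) ≤ A * Q ^ 3) :
    (∀ k, 1 ≤ k → k ≤ Kb → Zk k) ∧
    (∀ k, 2 ≤ k → k ≤ Kb → ∀ p : ℕ, 3 ≤ p → p ≤ D →
      klTowerBornWtPowAt L M β U μ K d (k - 1) j Dw (2 * p) / klLevUnitF β M 0 p (d * (k - 1)) ≤ A * lam ^ (p - 1) * Q ^ p) ∧
    (∀ k, 1 ≤ k → k ≤ Kb → ∀ m, 4 ≤ m → m ≤ D →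
      W * Z ^ m * (klTowerMeasWtPowAt L M β U μ K d k j Dw (2 * m) / klLevUnitF β M 0 m (d * k - 1)) ≤ A' * lam ^ (m - 1) * Q' ^ m) ∧
    (∀ k, 1 ≤ k → k ≤ Kb →
      klTowerBornWtPowSubTadAt L M β U μ K d k j Dw 2 / klLevUnitF β M 0 1 (d * k) ≤
        15 * σ ^ 2 * (ι₃ * lam ^ 2) + A' * (4 * Q') * ((4 * σ * lam * Q') ^ 3 / (1 - 4 * σ * lam * Q')) +
          exp 1 * ψ * (τ * (ι₁ * lam + ι₂ / (2 * Q') + ι₃ / (4 * Q' ^ 2) + A' * Q' / 4)) *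
            (Φ * (τ * (ι₁ * lam + ι₂ / (2 * Q') + ι₃ / (4 * Q' ^ 2) + A' * Q' / 4)) /
              (1 - Φ * (τ * (ι₁ * lam + ι₂ / (2 * Q') + ι₃ / (4 * Q' ^ 2) + A' * Q' / 4))))) := by
  obtain ⟨hZall, hlaw, hrows⟩ := klTowerBornWtPowAt_le_law_of_inputs_base_tokX (L := L) (M := M) hβ U μ K j d Kb D Dw hD3 hA hlam hQ hW hZ hA'0 hQ'0
    hσ hΦ hψ hτ hbase hR hι₁ hι₂ hι₃ hZ1 hZsucc hstep hx₁ hx₂ hx₃ hy hθ hu₁ hu₂ hclose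
  exact ⟨hZall, hlaw, hrows, klTowerBornWtPowSubTadAt_two_le_of_rows (L := L) (M := M) U μ K j d Kb D Dw hlam hA'0 hQ'0 hσ hΦ hψ hτ
    (fun k m => towerMuWtPow_nonneg hβ U μ K d k j Dw m hW hZ) hrows hι₁ hι₂ hι₃ hZall hstep₂ hx₁ hx₂ hx₃ hy hθ⟩

end LawTwoLeg

end Summit.HubbardSuperconductivity.HubbardSuperconductivity.Theorems.EngineV8

end
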